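import Summits.BirchSwinnertonDyer.BirchSwinnertonDyer.Theorems.TwoAdicConverseMultSplitWeakEZ
import Summits.BirchSwinnertonDyer.BirchSwinnertonDyer.Theorems.TwoAdicConverseMultLambdaRoad
import Summits.BirchSwinnertonDyer.BirchSwinnertonDyer.Theorems.ByReductionTypeAtTwoMultKatoNonsplitDescent
import Summits.BirchSwinnertonDyer.Rank1Residual.X5.TwoAdicTargetsMultDoorsTwinA
import HarnessLib

/-!
# Route `TwoAdicConverse` (rung S3), multiplicative branch, NON-SPLIT sign: the research WALL of LINE `cycint`
# in `λ`-FORM on the KERNEL K11a — items stmt-BirchSwinnertonDyer-19219 `MultiplicativeRankZeroTwoConverse` /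
# 19187 `MultTwoConverseOverKAtTwo` (helper; composition of LINE `cycint` v4)

Cell `bsd-2adic` (run/shared/lean/pub/bsd-2adic/), seat `bsd-2adic-conv-2` (GEN 12). THEOREMS ONLY — nothing asserted,
no definition, no named fact, no class booked; BSD is not proved by any of this. PARTITION (D-0054): none — RANK axis
(S3 mult, non-split sign); companion formula cell X5@2 mult (K4ᵐ, B1·O1; 1 273 non-split of 1 976 book230 classes).

WHY THIS FILE EXISTS. The registered LINE `cycint` (v3, `Cruxes/MultTwoConverseOverKAtTwo/Lines/cycint.lean`, seat conv-2
GEN 9) carries two research stubs, one per sign of `a₂`, each asking the INTEGRAL Eisenstein direction of the `2`-adic main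
conjecture `X5.O1.MultEisensteinDivisibilityAtTwo` (Néron period `ϖ`, `μ`-sensitive) at SOME globally minimal member of
the isogeny class of every non-CM curve multiplicative at `2` with finite `Sel_{2^∞}`. Seats conv-2 GEN 5/6/7 recorded the
trigger «K11a in the kernel ⇒ the non-split wall in `λ`-form»: Kato's `⊗ℚ` divisibility at a NON-SPLIT multiplicative `2`
is now a KERNEL theorem modulo PRINT-located Literature inputs only — `MultKatoRat.katoMultiplicativeDivisibilityRat_two_of_descent_nonsplit`
(seat bsd-2adic-mult GEN 10, p487637) from `Kato2004.nonempty_iwasawaH1Data` (`hne`), `Kato2004.thm12_4` (`h12`), the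
construction fact `Kato2004.exists_multDivisibilityInputsDescent_nonsplit` (`hdesc`, p486272; audit
D-AUDIT-K11inputs-…-ADDENDUM-3: print-by-ingredients + one labelled prime-independent folklore bridge) and Greenberg's
Thm. 1.5 (`h15`). With Kato on the upper side, the `λ`-road of this seat's GEN 0 (`multLowerDivisibilityAtTwoRat_of_katoRat_of_lambdaPart`,
p419187: two opposite `⊗ℚ` divisibilities pin `λ`) makes the WEAKER object

  **λ-WALL-ns**: for every non-CM globally minimal `W` NON-SPLIT multiplicative at `2` with `corank_{ℤ₂} Sel_{2^∞}(W/ℚ) = 0`,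
  every cyclotomic datum, newform `f` of `W`, dual datum `D` with `char_Λ X = (g)`, and every `h ∈ Λ`, `n` with
  `ι(g·h) = 2ⁿ·L₂(f)`: `g·h ≠ 0` and `λ(g·h) ≤ λ(g)` — i.e. «`λ_an ≤ λ_alg`» AT `W` (no `μ`, no period `ϖ`, no
  isogeny hedge, `λ(0) = ∞` convention)

sufficient for the NON-SPLIT half of the converse. This file proves, by name and sorry-free:

* §1 `lam_mul_le_of_C_mul_eq` — pure `Λ`-algebra: two opposite divisibilities with ANY nonzero constant pin `λ`
  (`λ(C c) = 0` is seat -ord's `LambdaConstPinch.lam_C`);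
* §2 the per-curve door `analyticRank_eq_zero_of_selmerCorank_eq_zero_nonsplit_two_of_lambdaPart_of_descent`: PRINT
  {A235-twin `h41ns`, modularity `hmod`, `h15`, `hne`, `h12`, `hdesc`} + the `λ`-part at `W` ⟹ (`corank 0 ⇒ L(E,1) ≠ 0 ∧
  r_an = 0`) — composition p487637 ∘ p419187 §2 ∘ mult GEN 7's primed door `X5.O1.analyticRank_eq_zero_of_finite_selmer_nonsplit_two'`;
* §3 the NON-SPLIT HALF of 19219 from λ-WALL-ns (`nonsplitMultRankZeroTwoConverse_of_lamWallNonsplit_of_descent`), and the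
  crux `MultiplicativeRankZeroTwoConverse` (19219) / the SERVED crux `MultTwoConverseOverKAtTwo` (19187) BY NAME from
  {λ-WALL-ns, the unchanged split wall of v3, Spieß 2014 Thm. 5.7 (PRINT)} — the composition of LINE `cycint` v4;
* §4 strength bookkeeping: the MEMBER-WISE integral Eisenstein direction at `W` implies the `λ`-part at `W`
  (`multLambdaPartNonsplit_of_multEisenstein`, with `hmod` supplying the rational period ratio), so the v4 stub is implied
  by the K4ᵐ object `MultEisensteinDivisibilityAtTwo W` on the finite-`Sel` non-split locus; v3's isogeny-hedged form
  implies it modulo the `⊗ℚ`-isogeny-invariance of `char_Λ X` (Perrin-Riou; the tree holds the `λ`-invariance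
  `X2.IsogenyLambdaInvariant.lambda_eq_of_isogeny` only) — recorded, not used.

HONEST FRAMING. λ-WALL-ns is NOT in print at `p = 2` (Greenberg–Vatsal 2000 and every Eisenstein-congruence argument keep
`p` odd; Burungale–Tian, Ann. Math. 203 (2026) p. 3 names the direction); restricted to the finite-`Sel` locus it still
says more than the converse (it speaks of every zero of `f_X`, not only `T = 0`); the rank-`0` 2-converse at a
multiplicative `2` stays OPEN class-wide; nothing is booked.

References: Kato, Astérisque 295 (2004) Thm. 12.4, Prop. 17.11 / Lemma 17.12, §17.13, Cor. 14.3 [Kato2004Asterisque];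
Greenberg, LNM 1716 (1999) Thm. 1.5 (p. 61), §4 pp. 112–113 [GreenbergLNM1716]; Greenberg–Vatsal, Invent. Math. 142 (2000)
p. 4 and §2 p. 28 [GreenbergVatsal2000]; Mazur–Tate–Teitelbaum, Invent. Math. 84 (1986) §I.14 [MazurTateTeitelbaum1986Invent];
Spieß, Invent. Math. 196 (2014) Thm. 5.7 [Spiess2014Invent]; Washington, GTM 83, §7.1 [Washington1997].
-/

set_option linter.dupNamespace false
set_option autoImplicit false

noncomputable section

open scoped Classical MatrixGroups ModularForm

open CongruenceSubgroup WeierstrassCurve Literature.NumberTheory.EllipticCurves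
  Literature.NumberTheory.EllipticCurves.ModularForms
  Literature.NumberTheory.EllipticCurves.Greenberg1999
  Literature.NumberTheory.EllipticCurves.Spiess2014
  Literature.NumberTheory.EllipticCurves.Rank1Residual
  Literature.NumberTheory.EllipticCurves.Rank1Residual.Typed
  Summit.BirchSwinnertonDyer.Rank1Residual.X1.MuLambda
  Summit.BirchSwinnertonDyer.Rank1Residual.X5
  Summit.BirchSwinnertonDyer.Rank1Residual.X5.O1
  Summit.BirchSwinnertonDyer.BirchSwinnertonDyer.Theses.TwoAdicConverse

namespace Summit.BirchSwinnertonDyer.BirchSwinnertonDyer.Theorems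

namespace MultLambdaWall

/-! ## §1 Pure `Λ`-algebra: two opposite divisibilities with an arbitrary nonzero constant -/

section Algebra

variable {p : ℕ} [Fact p.Prime]

/-- **Two opposite divisibilities with an arbitrary nonzero constant pin `λ`.** If `C c · g = k · (g·h)` in `Λ` with
`c ∈ ℤ_p` nonzero and `g ≠ 0`, then `g·h ≠ 0` and `λ(g·h) ≤ λ(g)` (`λ(C c) = 0`, seat -ord's `LambdaConstPinch.lam_C`;
`λ` additive). The `⊗ℚ` pinch `lam_mul_eq_of_opposite_divisibility` of the `λ`-road is the case `c = pⁿ`. [cite: GreenbergVatsal2000, p. 4 (after Thm. (1.2))] -/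
theorem lam_mul_le_of_C_mul_eq {c : ℤ_[p]} (hc : c ≠ 0) {g h k : IwasawaAlgebra p} (hg : g ≠ 0)
    (heq : PowerSeries.C c * g = k * (g * h)) : g * h ≠ 0 ∧ lam (g * h) ≤ lam g := by
  have hC0 : (PowerSeries.C c : IwasawaAlgebra p) ≠ 0 := by
    rw [Ne, ← map_zero (PowerSeries.C (R := ℤ_[p])), PowerSeries.C_injective.eq_iff]
    exact hc
  have hgh : g * h ≠ 0 := by
    intro h0
    rw [h0, mul_zero] at heq
    exact (mul_ne_zero hC0 hg) heq
  have hk : k ≠ 0 := by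
    intro h0
    rw [h0, zero_mul] at heq
    exact (mul_ne_zero hC0 hg) heq
  refine ⟨hgh, ?_⟩
  have hl := congrArg lam heq
  rw [lam_mul hC0 hg, LambdaConstPinch.lam_C hc, lam_mul hk hgh] at hl
  omega

end Algebra

/-! ## §2 The per-curve door at a NON-SPLIT multiplicative `2`: PRINT-located Kato inputs + the `λ`-part at `W` -/

section PerCurve

variable (W : WeierstrassCurve ℚ) [W.IsElliptic] [W.IsGloballyMinimal]

/-- **Rank-`0` `2`-converse at a NON-SPLIT multiplicative `2` from the `λ`-part at `W` and PRINT-located inputs only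
(no memo binder, no Summits conjecture constant).** `E/ℚ` (globally minimal `W`) non-split multiplicative at `2`;
PRINT {Greenberg's guarded non-split display A235-twin `h41ns`, modularity `hmod`, Greenberg Thm. 1.5 `h15`, Kato's
construction/statement facts `hne` / `h12`, the descended divisibility package `hdesc`} and the `λ`-PART at `W` (`hlam`:
for every cyclotomic datum, newform `f` of `W`, dual datum `D` with `char_Λ X = (g)`, every `h`, `n` with
`ι(g·h) = 2ⁿ·L₂(f,−1)`: `g·h ≠ 0 ∧ λ(g·h) ≤ λ(g)`). If `corank_{ℤ₂} Sel_{2^∞}(E/ℚ) = 0` then `L(E,1) ≠ 0` and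
`r_an(E) = 0`. Chain: K11a kernel (`MultKatoRat.katoMultiplicativeDivisibilityRat_two_of_descent_nonsplit`) ⇒ with `hlam`
T-mult-4 `⊗ℚ` at `W` (`multLowerDivisibilityAtTwoRat_of_katoRat_of_lambdaPart`, the split clause being vacuous) ⇒ the primed
door `X5.O1.analyticRank_eq_zero_of_finite_selmer_nonsplit_two'` (A235-twin: `f_E(0) ≠ 0`; MTT `L₂(0) = 2·[0]⁺_f`).
[cite: Kato2004Asterisque, Thm. 17.4 (1)(2) (p. 273; shape) and §17.13 (pp. 279–280)]
[cite: GreenbergLNM1716, §4 pp. 112–113 and Thm. 1.5 (p. 61)] [cite: MazurTateTeitelbaum1986Invent, §I.14] -/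
theorem analyticRank_eq_zero_of_selmerCorank_eq_zero_nonsplit_two_of_lambdaPart_of_descent
    (h41ns : thm41Analogue_charValue_rankZero_numberField_anyPrime_oddLocalDegree)
    (hmod : nonempty_modularParametrizationData) (h15 : thm15_isTorsion_multiplicative_rat)
    (hne : Kato2004.nonempty_iwasawaH1Data) (h12 : Kato2004.thm12_4)
    (hdesc : Kato2004.exists_multDivisibilityInputsDescent_nonsplit)
    (hmult : Mult W 2) (hns : ¬ W.HasSplitMultiplicativeReductionAtPrime 2)
    (hlam : ∀ (κ : ZpExtension ℚ 2) (γ : Field.absoluteGaloisGroup ℚ), κ.IsCyclotomic →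
      κ.IsTopGenerator γ → IsCyclotomicVariable 2 γ →
      ∀ ⦃N : ℕ⦄ [NeZero N] (f : CuspForm (Gamma0 N) 2), IsNewformOf W f →
      ∀ (D : W.SelmerDualData κ γ) (g h : IwasawaAlgebra 2) (n : ℕ), D.charIdeal = Ideal.span {g} →
      ∀ L : PowerSeries ℚ_[2], IsMultPAdicLFunctionOf f 2 (-1) L →
        iwasawaToPowerSeries 2 (g * h) = PowerSeries.C ((2 : ℚ_[2]) ^ n) * L →
        g * h ≠ 0 ∧ lam (g * h) ≤ lam g)
    (hsel : W.selmerCorank 2 = 0) :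
    W.entireLFunction 1 ≠ 0 ∧ W.analyticRank = 0 := by
  have hKato : KatoMultiplicativeDivisibilityRat W 2 :=
    MultKatoRat.katoMultiplicativeDivisibilityRat_two_of_descent_nonsplit W hns hne h12 hdesc h15
  have hlow : MultLowerDivisibilityAtTwoRat W :=
    multLowerDivisibilityAtTwoRat_of_katoRat_of_lambdaPart W hKato
      (fun κ γ hκ hγ hγ' _ N _ f hf D g h n hchar =>
        ⟨fun _ L hL hι => hlam κ γ hκ hγ hγ' f hf D g h n hchar L hL hι, fun hsp => absurd hsp hns⟩)
  have hfin : Finite (W.selmerGroupPInfty 2) :=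
    (finite_selmerGroupPInfty_iff_selmerCorank_eq_zero W 2).mpr hsel
  exact analyticRank_eq_zero_of_finite_selmer_nonsplit_two' W h41ns hmod
    (fun f L => katoDivisibilityAtTwoNonsplitMultRat_of_multRat W hKato f L) hlow hmult hns hfin

end PerCurve

/-! ## §3 The NON-SPLIT half of 19219 from λ-WALL-ns, and the composition of LINE `cycint` v4 -/

/-- **NON-SPLIT half of the crux from λ-WALL-ns + PRINT-located inputs.** PRINT {A235-twin `h41ns`, modularity `hmod`,
Greenberg Thm. 1.5 `h15`, Kato `hne` / `h12`, the descended package `hdesc`} and λ-WALL-ns (`hWlam`: the `λ`-part at `W`,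
asked only for non-CM `W` NON-SPLIT multiplicative at `2` with `corank_{ℤ₂} Sel_{2^∞}(W/ℚ) = 0`) ⟹ for every such `W`:
`r_an(W) = 0`. §2 at `W` itself — no isogeny transport, no `μ`, no period. This is the non-split road of LINE `cycint`
v4 (replacing v3's `MultWalls.nonsplitMultRankZeroTwoConverse_of_wallS3`).
[cite: Kato2004Asterisque, Thm. 17.4 (1)(2) (p. 273; shape) and §17.13 (pp. 279–280)]
[cite: GreenbergLNM1716, §4 pp. 112–113 and Thm. 1.5 (p. 61)] [cite: GreenbergVatsal2000, p. 4 (after Thm. (1.2))] -/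
theorem nonsplitMultRankZeroTwoConverse_of_lamWallNonsplit_of_descent
    (h41ns : thm41Analogue_charValue_rankZero_numberField_anyPrime_oddLocalDegree)
    (hmod : nonempty_modularParametrizationData) (h15 : thm15_isTorsion_multiplicative_rat)
    (hne : Kato2004.nonempty_iwasawaH1Data) (h12 : Kato2004.thm12_4)
    (hdesc : Kato2004.exists_multDivisibilityInputsDescent_nonsplit)
    (hWlam : ∀ (W : WeierstrassCurve ℚ) [W.IsElliptic] [W.IsGloballyMinimal], ¬ W.HasCM → Mult W 2 →
      ¬ W.HasSplitMultiplicativeReductionAtPrime 2 → W.selmerCorank 2 = 0 →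
      ∀ (κ : ZpExtension ℚ 2) (γ : Field.absoluteGaloisGroup ℚ), κ.IsCyclotomic →
      κ.IsTopGenerator γ → IsCyclotomicVariable 2 γ →
      ∀ ⦃N : ℕ⦄ [NeZero N] (f : CuspForm (Gamma0 N) 2), IsNewformOf W f →
      ∀ (D : W.SelmerDualData κ γ) (g h : IwasawaAlgebra 2) (n : ℕ), D.charIdeal = Ideal.span {g} →
      ∀ L : PowerSeries ℚ_[2], IsMultPAdicLFunctionOf f 2 (-1) L →
        iwasawaToPowerSeries 2 (g * h) = PowerSeries.C ((2 : ℚ_[2]) ^ n) * L →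
        g * h ≠ 0 ∧ lam (g * h) ≤ lam g) :
    ∀ (W : WeierstrassCurve ℚ) [W.IsElliptic] [W.IsGloballyMinimal], ¬ W.HasCM → Mult W 2 →
      ¬ W.HasSplitMultiplicativeReductionAtPrime 2 → W.selmerCorank 2 = 0 → W.analyticRank = 0 :=
  fun W _ _ hcm hmult hns hsel =>
    (analyticRank_eq_zero_of_selmerCorank_eq_zero_nonsplit_two_of_lambdaPart_of_descent W h41ns hmod h15 hne
      h12 hdesc hmult hns (hWlam W hcm hmult hns hsel) hsel).2

/-- **The crux `MultiplicativeRankZeroTwoConverse` (item 19219) from λ-WALL-ns + the SPLIT wall + PRINT only.** PRINT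
{A235-twin, A236, modularity, Greenberg Thm. 1.5, Kato `hne`/`h12`, `hdesc`, Spieß 2014 Thm. 5.7 at every split-at-`2` curve}
+ λ-WALL-ns (`hWlam`) + WALL-S3-sp of LINE `cycint` v3 (`hWsp`: integral Eisenstein direction at SOME isogenous minimal
member, split sign, finite-`Sel` locus) ⟹ 19219, by `multiplicativeRankZeroTwoConverse_iff_bySign` with the split half
`MultSplitWeakEZ.splitMultRankZeroTwoConverse_of_wallS3_of_weakEZ` (seat mult-gs-c, p462242) unchanged.
[cite: Spiess2014Invent, Thm. 5.7] [cite: GreenbergLNM1716, §4 pp. 112–113 and Thm. 1.5 (p. 61)]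
[cite: Kato2004Asterisque, Thm. 17.4 (1)(2) (p. 273; shape) and §17.13 (pp. 279–280)] -/
theorem multiplicativeRankZeroTwoConverse_of_lamWallNonsplit_of_wallSplit_of_weakEZ
    (h41ns : thm41Analogue_charValue_rankZero_numberField_anyPrime_oddLocalDegree)
    (h41sp : thm41Analogue_charValue_rankZero_split_baseChange_anyPrime)
    (hmod : nonempty_modularParametrizationData) (h15 : thm15_isTorsion_multiplicative_rat)
    (hne : Kato2004.nonempty_iwasawaH1Data) (h12 : Kato2004.thm12_4)
    (hdesc : Kato2004.exists_multDivisibilityInputsDescent_nonsplit)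
    (hW : ∀ (W : WeierstrassCurve ℚ) [W.IsElliptic] [W.IsGloballyMinimal],
      W.HasSplitMultiplicativeReductionAtPrime 2 → thm57_weakExceptionalZero_splitMultiplicative_rat W 2)
    (hWlam : ∀ (W : WeierstrassCurve ℚ) [W.IsElliptic] [W.IsGloballyMinimal], ¬ W.HasCM → Mult W 2 →
      ¬ W.HasSplitMultiplicativeReductionAtPrime 2 → W.selmerCorank 2 = 0 →
      ∀ (κ : ZpExtension ℚ 2) (γ : Field.absoluteGaloisGroup ℚ), κ.IsCyclotomic →
      κ.IsTopGenerator γ → IsCyclotomicVariable 2 γ →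
      ∀ ⦃N : ℕ⦄ [NeZero N] (f : CuspForm (Gamma0 N) 2), IsNewformOf W f →
      ∀ (D : W.SelmerDualData κ γ) (g h : IwasawaAlgebra 2) (n : ℕ), D.charIdeal = Ideal.span {g} →
      ∀ L : PowerSeries ℚ_[2], IsMultPAdicLFunctionOf f 2 (-1) L →
        iwasawaToPowerSeries 2 (g * h) = PowerSeries.C ((2 : ℚ_[2]) ^ n) * L →
        g * h ≠ 0 ∧ lam (g * h) ≤ lam g)
    (hWsp : ∀ (W : WeierstrassCurve ℚ) [W.IsElliptic] [W.IsGloballyMinimal], ¬ W.HasCM → Mult W 2 →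
      W.HasSplitMultiplicativeReductionAtPrime 2 → W.selmerCorank 2 = 0 →
        ∃ (W' : WeierstrassCurve ℚ) (_ : W'.IsElliptic) (_ : W'.IsGloballyMinimal),
          IsIsogenous W W' ∧ Mult W' 2 ∧ MultEisensteinDivisibilityAtTwo W') :
    MultiplicativeRankZeroTwoConverse :=
  multiplicativeRankZeroTwoConverse_iff_bySign.mpr
    ⟨nonsplitMultRankZeroTwoConverse_of_lamWallNonsplit_of_descent h41ns hmod h15 hne h12 hdesc hWlam,
      MultSplitWeakEZ.splitMultRankZeroTwoConverse_of_wallS3_of_weakEZ h41sp hmod h15 hW hWsp⟩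

/-- **The SERVED crux `MultTwoConverseOverKAtTwo` (item 19187) — composition of LINE `cycint` v4.** The route's PUB child
`MultConversePublishedInputsAtTwo` (`hP`, item 19185) + PRINT {A235-twin, A236, modularity, Thm. 1.5, Kato `hne`/`h12`,
`hdesc`, Spieß Thm. 5.7} + λ-WALL-ns + WALL-S3-sp ⟹ 19187, through `19219 ⟹ 19187` modulo PUB
(`multTwoConverseOverKAtTwo_of_multiplicativeRankZeroTwoConverse`, p418586).
[cite: Kato2004Asterisque, Cor. 14.3 (p. 235) and §17.13 (pp. 279–280)] [cite: Spiess2014Invent, Thm. 5.7]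
[cite: GreenbergLNM1716, §4 pp. 112–113 and Thm. 1.5 (p. 61)] -/
theorem multTwoConverseOverKAtTwo_of_lamWallNonsplit_of_wallSplit_of_weakEZ (hP : MultConversePublishedInputsAtTwo)
    (h41ns : thm41Analogue_charValue_rankZero_numberField_anyPrime_oddLocalDegree)
    (h41sp : thm41Analogue_charValue_rankZero_split_baseChange_anyPrime)
    (hmod : nonempty_modularParametrizationData) (h15 : thm15_isTorsion_multiplicative_rat)
    (hne : Kato2004.nonempty_iwasawaH1Data) (h12 : Kato2004.thm12_4)
    (hdesc : Kato2004.exists_multDivisibilityInputsDescent_nonsplit)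
    (hW : ∀ (W : WeierstrassCurve ℚ) [W.IsElliptic] [W.IsGloballyMinimal],
      W.HasSplitMultiplicativeReductionAtPrime 2 → thm57_weakExceptionalZero_splitMultiplicative_rat W 2)
    (hWlam : ∀ (W : WeierstrassCurve ℚ) [W.IsElliptic] [W.IsGloballyMinimal], ¬ W.HasCM → Mult W 2 →
      ¬ W.HasSplitMultiplicativeReductionAtPrime 2 → W.selmerCorank 2 = 0 →
      ∀ (κ : ZpExtension ℚ 2) (γ : Field.absoluteGaloisGroup ℚ), κ.IsCyclotomic →
      κ.IsTopGenerator γ → IsCyclotomicVariable 2 γ →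
      ∀ ⦃N : ℕ⦄ [NeZero N] (f : CuspForm (Gamma0 N) 2), IsNewformOf W f →
      ∀ (D : W.SelmerDualData κ γ) (g h : IwasawaAlgebra 2) (n : ℕ), D.charIdeal = Ideal.span {g} →
      ∀ L : PowerSeries ℚ_[2], IsMultPAdicLFunctionOf f 2 (-1) L →
        iwasawaToPowerSeries 2 (g * h) = PowerSeries.C ((2 : ℚ_[2]) ^ n) * L →
        g * h ≠ 0 ∧ lam (g * h) ≤ lam g)
    (hWsp : ∀ (W : WeierstrassCurve ℚ) [W.IsElliptic] [W.IsGloballyMinimal], ¬ W.HasCM → Mult W 2 →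
      W.HasSplitMultiplicativeReductionAtPrime 2 → W.selmerCorank 2 = 0 →
        ∃ (W' : WeierstrassCurve ℚ) (_ : W'.IsElliptic) (_ : W'.IsGloballyMinimal),
          IsIsogenous W W' ∧ Mult W' 2 ∧ MultEisensteinDivisibilityAtTwo W') :
    MultTwoConverseOverKAtTwo :=
  multTwoConverseOverKAtTwo_of_multiplicativeRankZeroTwoConverse hP
    (multiplicativeRankZeroTwoConverse_of_lamWallNonsplit_of_wallSplit_of_weakEZ h41ns h41sp hmod h15 hne h12 hdesc
      hW hWlam hWsp)

/-! ## §4 Strength bookkeeping: the member-wise integral Eisenstein direction at `W` implies the `λ`-part at `W` -/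

section Strength

variable (W : WeierstrassCurve ℚ) [W.IsElliptic] [W.IsGloballyMinimal]

/-- **T-mult-4-int at `W` (non-split clause) ⟹ the `λ`-part at `W`.** Modularity `hmod` supplies, for the (unique,
`IsNewformOf.unique`, `IsNewformOf.level_eq_level`) newform `f` of `W`, a rational `ϖ > 0` with `ϖ·Ω_W = Ω⁺_f`
(`ModularParametrizationData.exists_rat_mul_realPeriodRat_eq_plusPeriod`); `MultEisensteinDivisibilityAtTwo W` then reads
`ι g = ι k · ϖ·L` for the generator `g` of `char_Λ X`; with `ι(g·h) = 2ⁿ·L` this gives `C(2ⁿ·d)·g = (k·C a)·(g·h)` in `Λ`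
(`ϖ = a/d`), whence `g·h ≠ 0` and `λ(g·h) ≤ λ(g)` (§1). So the v4 research stub of LINE `cycint` (λ-WALL-ns) is implied
by the K4ᵐ member-wise object on the same locus; nothing asserted. [cite: GreenbergVatsal2000, p. 4 (after Thm. (1.2))]
[cite: GreenbergLNM1716, §4 pp. 112–113] -/
theorem multLambdaPartNonsplit_of_multEisenstein (hmod : nonempty_modularParametrizationData)
    (hmult : Mult W 2) (hns : ¬ W.HasSplitMultiplicativeReductionAtPrime 2)
    (hE : MultEisensteinDivisibilityAtTwo W) :
    ∀ (κ : ZpExtension ℚ 2) (γ : Field.absoluteGaloisGroup ℚ), κ.IsCyclotomic →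
      κ.IsTopGenerator γ → IsCyclotomicVariable 2 γ →
      ∀ ⦃N : ℕ⦄ [NeZero N] (f : CuspForm (Gamma0 N) 2), IsNewformOf W f →
      ∀ (D : W.SelmerDualData κ γ) (g h : IwasawaAlgebra 2) (n : ℕ), D.charIdeal = Ideal.span {g} →
      ∀ L : PowerSeries ℚ_[2], IsMultPAdicLFunctionOf f 2 (-1) L →
        iwasawaToPowerSeries 2 (g * h) = PowerSeries.C ((2 : ℚ_[2]) ^ n) * L →
        g * h ≠ 0 ∧ lam (g * h) ≤ lam g := by
  intro κ γ hκ hγ hγ' N _ f hf D g h n hchar L hL hι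
  haveI : NeZero (W.conductorNorm ℤ) := ⟨(W.conductorNorm_pos_holds).ne'⟩
  obtain ⟨Dm⟩ := hmod W
  have hfm : IsNewformOf W Dm.f := Dm.isNewformOf
  obtain ⟨ϖ, hϖpos, hϖ, -⟩ := Dm.exists_rat_mul_realPeriodRat_eq_plusPeriod
  -- the given newform `f` IS the datum's newform: same level, then uniqueness of the newform of `W`
  obtain rfl : N = W.conductorNorm ℤ := hf.level_eq_level hfm
  have hff : f = Dm.f := hf.unique hfm
  have hϖf : (ϖ : ℝ) * W.realPeriodRat = plusPeriod f := by rw [hff]; exact hϖ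
  -- T-mult-4-int, non-split clause at `(f, ϖ, D, g)`
  obtain ⟨hns', -⟩ := hE κ γ hκ hγ hγ' hmult f hf ϖ hϖf D g hchar
  obtain ⟨k, hk⟩ := hns' hns L hL
  have hg : g ≠ 0 := generator_ne_zero_of_charIdeal_eq W D hchar
  -- clear the denominator of `ϖ = a/d`: `C(2ⁿ·d)·ι g = ι(k·C a)·ι(g·h)`
  have hϖ0 : ϖ ≠ 0 := hϖpos.ne'
  have hden : (ϖ.den : ℚ) ≠ 0 := Nat.cast_ne_zero.mpr ϖ.den_nz
  have hnum : ϖ.num ≠ 0 := Rat.num_ne_zero.mpr hϖ0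
  have hϖeq : ((ϖ.den : ℚ) : ℚ_[2]) * (ϖ : ℚ_[2]) = ((ϖ.num : ℚ) : ℚ_[2]) := by
    rw [← Rat.cast_mul, Rat.den_mul_eq_num]
  have key : iwasawaToPowerSeries 2 (PowerSeries.C (((2 : ℤ_[2]) ^ n) * (ϖ.den : ℤ_[2])) * g) =
      iwasawaToPowerSeries 2 ((k * PowerSeries.C ((ϖ.num : ℤ) : ℤ_[2])) * (g * h)) := by
    have e1 : iwasawaToPowerSeries 2 (PowerSeries.C (((2 : ℤ_[2]) ^ n) * (ϖ.den : ℤ_[2])) * g) =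
        PowerSeries.C (((2 : ℚ_[2]) ^ n) * ((ϖ.den : ℚ) : ℚ_[2])) * iwasawaToPowerSeries 2 g := by
      rw [map_mul, PowerSeries.map_C]
      congr 2
    have e2 : iwasawaToPowerSeries 2 ((k * PowerSeries.C ((ϖ.num : ℤ) : ℤ_[2])) * (g * h)) =
        iwasawaToPowerSeries 2 k * PowerSeries.C (((ϖ.num : ℚ) : ℚ_[2])) * iwasawaToPowerSeries 2 (g * h) := by
      rw [map_mul, map_mul, PowerSeries.map_C]
      congr 2
    rw [e1, e2, hι, hk, ← hϖeq, map_mul PowerSeries.C, map_mul PowerSeries.C]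
    ring
  have heq : PowerSeries.C (((2 : ℤ_[2]) ^ n) * (ϖ.den : ℤ_[2])) * g =
      (k * PowerSeries.C ((ϖ.num : ℤ) : ℤ_[2])) * (g * h) := iwasawaToPowerSeries_injective 2 key
  have hc : ((2 : ℤ_[2]) ^ n) * (ϖ.den : ℤ_[2]) ≠ 0 := by
    refine mul_ne_zero (pow_ne_zero n two_ne_zero) ?_
    exact_mod_cast ϖ.den_nz
  exact lam_mul_le_of_C_mul_eq hc hg heq

end Strength

/-- **Corollary (v4 ≤ member-wise T-mult-4-int on the same locus).** PRINT {A235-twin, modularity, Thm. 1.5, Kato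
`hne`/`h12`, `hdesc`} and the MEMBER-WISE integral Eisenstein direction at every non-CM `W` NON-SPLIT multiplicative at
`2` with `corank_{ℤ₂} Sel_{2^∞}(W/ℚ) = 0` (`hEns`, the K4ᵐ object `X5.O1.MultEisensteinDivisibilityAtTwo W` AT `W`, no
isogeny hedge) ⟹ the NON-SPLIT half of 19219 — through λ-WALL-ns (`multLambdaPartNonsplit_of_multEisenstein` then
`nonsplitMultRankZeroTwoConverse_of_lamWallNonsplit_of_descent`). Bookkeeping: the `λ`-form wall asks no more than the
member-wise integral wall. [cite: GreenbergLNM1716, §4 pp. 112–113 and Thm. 1.5 (p. 61)]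
[cite: Kato2004Asterisque, Thm. 17.4 (1)(2) (p. 273; shape) and §17.13 (pp. 279–280)] -/
theorem nonsplitMultRankZeroTwoConverse_of_multEisensteinFinSel_of_descent
    (h41ns : thm41Analogue_charValue_rankZero_numberField_anyPrime_oddLocalDegree)
    (hmod : nonempty_modularParametrizationData) (h15 : thm15_isTorsion_multiplicative_rat)
    (hne : Kato2004.nonempty_iwasawaH1Data) (h12 : Kato2004.thm12_4)
    (hdesc : Kato2004.exists_multDivisibilityInputsDescent_nonsplit)
    (hEns : ∀ (W : WeierstrassCurve ℚ) [W.IsElliptic] [W.IsGloballyMinimal], ¬ W.HasCM → Mult W 2 →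
      ¬ W.HasSplitMultiplicativeReductionAtPrime 2 → W.selmerCorank 2 = 0 → MultEisensteinDivisibilityAtTwo W) :
    ∀ (W : WeierstrassCurve ℚ) [W.IsElliptic] [W.IsGloballyMinimal], ¬ W.HasCM → Mult W 2 →
      ¬ W.HasSplitMultiplicativeReductionAtPrime 2 → W.selmerCorank 2 = 0 → W.analyticRank = 0 :=
  nonsplitMultRankZeroTwoConverse_of_lamWallNonsplit_of_descent h41ns hmod h15 hne h12 hdesc
    (fun W _ _ hcm hmult hns hsel =>
      multLambdaPartNonsplit_of_multEisenstein W hmod hmult hns (hEns W hcm hmult hns hsel))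

end MultLambdaWall

end Summit.BirchSwinnertonDyer.BirchSwinnertonDyer.Theorems

end
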